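import Literature.AlgebraicGeometry.HodgeTheory.BettiHodgeConjectureProductOfSurfacesCorrespondenceCriterion
import Literature.AlgebraicGeometry.HodgeTheory.CorrespondenceActionOfGraph
import Literature.AlgebraicGeometry.HodgeTheory.ComplexOrientationCycleClassFacts
import Literature.AlgebraicGeometry.HodgeTheory.GysinFormalismHodgeOfGysin
import Literature.AlgebraicGeometry.Motives.HodgeTensorFactsHolds
import HarnessLib

/-!
# Route `Q8SymplecticPowers`, programme K2Q — brick S2 part (G): the `(2,2)`-Künneth component of the GRAPH CLASS of a
# self-map of a surface is an algebraic Hodge class of `H²(S) ⊗ H²(S)` acting as `σ^*` on `H²(S; ℂ)`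

Support file for crux K2Q `PowersHodgeOfQuaternionCommutators` (stmt-HodgeConjecture-24191; `--supports … --as helper`;
nothing here closes an item).  Prover seat `hodge-nonav-20241-p1` (g20).

**`exists_kunneth_two_two_algebraic_corrAction_eq_map`** — for a smooth projective surface `S` and `σ : S ⟶ S` there is a
Hodge class `t_σ ∈ Hdg²(H²S ⊗ H²S)` with `crossMap t_σ ⊗ 1` ALGEBRAIC on `S × S` and `(crossMap t_σ ⊗ 1)_* = σ^*` on
`H²(S(ℂ); ℂ)` (the analogue for graphs of the tree's `exists_kunneth_two_two_algebraic_corrAction_eq_id` for the diagonal).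
Proof: the graph class `γ_σ = (𝟙, σ)₊ 1 ∈ H⁴((S × S)(ℂ); ℂ)` is algebraic (`gysinGraph_one_mem_algebraicClasses`), rational
for the complex orientation family (`isRationalClass_complexGysin_complexOrientationFamily`), and acts as `𝟙₊ ∘ σ^* = σ^*`
(`corrAction_gysinGraph_one`, `complexGysin_id`); the tree's `exists_kunneth_two_two_algebraic_corrAction_eq` extracts its
`(2,2)`-component.  This is the supply of the three extra correspondences `t_τ, t_j, t_{τj}` of the S2 half of the square case
(memo PROGRAMME-K2Q); the divisor products and the independence count are not in this file.
HONEST FRAMING: axioms standard; item 24191 OPEN; nothing here says HC ∕ HC_CM ∕ HC_AV is proved.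

## References

* W. Fulton, *Intersection Theory* (1998), §16.1 Prop. 16.1.1–16.1.2. [cite: Fulton1998]
* C. Voisin, *Hodge Theory and Complex Algebraic Geometry I* (2002), §11.3.3 Thm. 11.38–11.40 and pp. 286–287.
  [cite: VoisinHodgeI2002]
-/

set_option linter.dupNamespace false

noncomputable section

open scoped TensorProduct
open CategoryTheory MonoidalCategory CartesianMonoidalCategory Module Finset
open Literature.AlgebraicTopology.SingularHomology
open Literature.AlgebraicGeometry.Motives Literature.AlgebraicGeometry.HodgeTheory
open Literature.AlgebraicGeometry.HodgeTheory.BettiUniverse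
open Literature.AlgebraicGeometry.Motives.HodgeStructure

namespace Summit.HodgeConjecture.HodgeConjecture.Theorems.Q8SymplecticPowersGraphCorrespondences

variable {S : SchemeOver ℂ}

/-- **The graph class `(𝟙, σ)₊ 1` of a self-map of a smooth projective surface is a RATIONAL ALGEBRAIC class of `H⁴(S × S)`
acting as `σ^*` on `H²(S; ℂ)`** (complex orientation family). [cite: Fulton1998, §16.1 Prop. 16.1.1 and Def. 16.1.2]
[cite: VoisinHodgeI2002, §7.3.2 and §11.3.3] -/
theorem exists_ratClass_algebraic_corrAction_eq_map (hS : IsSmoothProjective 2 S) (σ : S ⟶ S) :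
    haveI : HodgeTensorFacts.{0, 0} := hodgeTensorFacts_holds
    ∃ γ : bettiCohomology (S ⊗ S) (2 * 2),
      ofRatClass (ComplexPoints (S ⊗ S)) (2 * 2) γ ∈ algebraicClasses (S ⊗ S) 2 ∧
      corrAction complexOrientationFamily hS hS (rfl : 2 + 2 * 2 = 2 + 2 * 2) (ofRatClass (ComplexPoints (S ⊗ S)) (2 * 2) γ) =
        (complexBetti.map σ 2).hom := by
  haveI : HodgeTensorFacts.{0, 0} := hodgeTensorFacts_holds
  -- the graph class `(𝟙, σ)₊ 1`
  have hrat := isRationalClass_complexGysin_complexOrientationFamily hS (hS.tensor_holds hS) (lift (𝟙 S) σ)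
    (show 0 + 2 * (2 + 2) = 2 * 2 + 2 * 2 by norm_num) (isRationalClass_one (ComplexPoints S))
  obtain ⟨γ, hγ⟩ := (isRationalClass_iff_mem_range_ofRatClass _).1 hrat
  refine ⟨γ, ?_, ?_⟩
  · rw [hγ]
    exact gysinGraph_one_mem_algebraicClasses complexOrientationFamily hasPoincareDuality_complexOrientationFamily hS hS
      (𝟙 S) σ (show 2 + 2 = 2 + 2 from rfl)
  · rw [hγ, corrAction_gysinGraph_one hasPoincareDuality_complexOrientationFamily hS hS (𝟙 S) σ (show 2 + 2 = 2 + 2 from rfl)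
      (rfl : 2 + 2 * 2 = 2 + 2 * 2), complexGysin_id hasPoincareDuality_complexOrientationFamily hS 2, LinearMap.id_comp]

/-- **The `(2,2)`-Künneth component of the graph class of a self-map `σ` of a smooth projective surface**: there is a Hodge
class `t_σ ∈ Hdg²(H²S ⊗ H²S)` with `crossMap t_σ ⊗ 1` algebraic on `S × S` and `(crossMap t_σ ⊗ 1)_* = σ^*` on
`H²(S(ℂ); ℂ)`. [cite: VoisinHodgeI2002, §11.3.3 Thm. 11.38–11.40 and pp. 286–287] [cite: Fulton1998, §16.1 Prop. 16.1.1] -/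
theorem exists_kunneth_two_two_algebraic_corrAction_eq_map (hS : IsSmoothProjective 2 S) (σ : S ⟶ S) :
    haveI : HodgeTensorFacts.{0, 0} := hodgeTensorFacts_holds
    ∃ t ∈ (kunnethSummand exists_isReal_hodgeModel_holds hS hS (2 * 2) ⟨(2, 2), HasAntidiagonal.mem_antidiagonal.2 rfl⟩).hodgeClasses 2,
      ofRatClass (ComplexPoints (S ⊗ S)) (2 * 2) (crossMap S S (show 2 + 2 = 2 * 2 by norm_num) t) ∈ algebraicClasses (S ⊗ S) 2 ∧
      corrAction complexOrientationFamily hS hS (rfl : 2 + 2 * 2 = 2 + 2 * 2)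
          (ofRatClass (ComplexPoints (S ⊗ S)) (2 * 2) (crossMap S S (show 2 + 2 = 2 * 2 by norm_num) t)) =
        (complexBetti.map σ 2).hom := by
  haveI : HodgeTensorFacts.{0, 0} := hodgeTensorFacts_holds
  obtain ⟨γ, hγ, hact⟩ := exists_ratClass_algebraic_corrAction_eq_map hS σ
  obtain ⟨t, ht, halg, hact'⟩ := exists_kunneth_two_two_algebraic_corrAction_eq complexOrientationFamily
    exists_isReal_hodgeModel_holds hS hS hγ
  exact ⟨t, ht, halg, hact'.trans hact⟩

end Summit.HodgeConjecture.HodgeConjecture.Theorems.Q8SymplecticPowersGraphCorrespondences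

end
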